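import Mathlib.RingTheory.Valuation.ValuationSubring
import Mathlib.RingTheory.AlgebraicIndependent.Basic
import Mathlib.RingTheory.Adjoin.Polynomial.Basic
import Mathlib.Algebra.Polynomial.RingDivision
import Mathlib.Algebra.Polynomial.Inductions
import Mathlib.FieldTheory.IsAlgClosed.Basic
import HarnessLib

/-!
# Embedded local uniformization in dimension `m` (Cutkosky–Mourtada 2019, Def. 1.2)

Topic: `Literature/AlgebraicGeometry/Resolution` (local uniformization of valued function
fields). S. D. Cutkosky, H. Mourtada, *Defect and local uniformization*, RACSAM 113 (2019)
4211–4226 = arXiv:1711.02726, §1, verbatim: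

> **Definition 1.2.** Embedded local uniformization holds in dimension `m` (ELU holds in
> dimension `m`) if the following is true: Suppose that `A = k[x₁,…,x_m]` is a polynomial ring
> in `m` variables over an algebraically closed field `k` and `ν` is a zero dimensional
> valuation of the quotient field `K` of `A` which dominates `A_𝔪` where `𝔪 = (x₁,…,x_m)`.
> Then if `0 ≠ f ∈ A`, there exists a birational extension `A → A₁` where `A₁` is a polynomial
> ring `A₁ = k[x₁(1),…,x_m(1)]` such that `ν` dominates `(A₁)_{𝔪₁}` where
> `𝔪₁ = (x₁(1),…,x_m(1))`, there exists `n ≤ m` such that `{ν(x₁(1)),…,ν(x_n(1))}` is a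
> rational basis of `Φ_ν ⊗ ℚ` and `f = x₁(1)^{b₁}⋯x_n(1)^{b_n} f̄` with `b₁,…,b_n ∈ ℕ` and
> `f̄ ∈ A₁ ∖ 𝔪₁`.

with, loc. cit.: "A valuation `ν` of an algebraic function field `K/k` is required to be trivial
on `k`"; "`ν` dominates `R` if `R ⊂ V_ν` … and `m_ν ∩ R = m_R`"; "zero dimensional if the
transcendence degree of the residue field of the valuation ring of `ν` over `k` is zero"; "An
extension of domains `R → S` is said to be birational if `R` and `S` have the same quotient
field"; `Φ_ν` the value group. And: "The problem is that we do not know ELU in dimension `4`,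
so we are unable to proceed to LU in dimension `4`." [CutkoskyMourtada2019]

This is the LOCAL embedded input that the barrier catalogue entry
`Literature.Barriers.ResolutionOfSingularities.DimensionFourFrontier` records as missing in
dimension `4` but does not formalise (its `scope_caveats` (b), (f)); it is typed here for the
dimension-`4` census of the cell `pub-hironaka` (unit `b2b-hironaka-cp4`, input O1, local form).

## Content

* `IsRationalBasis v γ` — a finite family of nonzero values is a rational basis of the value
  group of `v` tensored with `ℚ`: multiplicatively independent over `ℤ`, and every value of a
  nonzero element has a positive power in the subgroup the family generates.
* `ELU k m` — Def. 1.2 over the ground field `k` (any field; the printed definition takes `k`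
  algebraically closed, `ELUInDim m`).
* `ELUInDim m` — "ELU holds in dimension `m`": `ELU k m` for every algebraically closed `k`.
* PROVED: `elu_one` — ELU holds in dimension `1` over every field (a nonzero polynomial in one
  variable is `x^b ·` (a polynomial with nonzero constant term), which is a unit at the centre;
  the value group of a valuation of `k(x)` dominating `k[x]_{(x)}` is rationally generated by
  `ν(x)`); sanity for the shape of the definition, not a claim of the source.

## Rendering notes

* `A = k[x₁,…,x_m]`, `K = Frac A` ↦ a field `K ⊇ k`, an algebraically independent family
  `x : Fin m → K` with `IsFractionRing (Algebra.adjoin k (range x)) K`; the birational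
  extension `A → A₁ = k[x₁(1),…,x_m(1)]` ↦ a second algebraically independent family
  `x₁ : Fin m → K` with `x i ∈ k[x₁]` for all `i` (then `A ⊆ A₁ ⊆ K = Frac A`, so `Frac A₁ = K`).
* `ν` ↦ a valuation ring `O` of `K`; "trivial on `k`" ↦ `k ⊆ O`; "`ν` dominates `A_𝔪`",
  `𝔪 = (x₁,…,x_m)` ↦ `x i ∈ O` and `ν(x i) < 1` for all `i` (then `𝔪 ⊆ m_ν ∩ A`, a proper
  ideal containing the maximal ideal `𝔪`, so `m_ν ∩ A = 𝔪`, `A_𝔪 ⊆ O` is dominated; and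
  conversely); likewise for `(A₁)_{𝔪₁}`; "`f̄ ∈ A₁ ∖ 𝔪₁`" ↦ `f̄ ∈ k[x₁]` with `ν(f̄) = 1`
  (equivalent, given domination: `𝔪₁ = m_ν ∩ A₁`).
* "zero dimensional" with `k` algebraically closed ↦ every element of `O` is congruent modulo
  `m_ν` to a constant: `∀ y ∈ O, ∃ c ∈ k, ν(y − c) < 1` (the residue field, algebraic over the
  algebraically closed `k ⊆ O`, is then `k`; conversely this says `κ(ν) = k`). For a general
  `k` this clause is STRONGER than residual algebraicity; `ELUInDim` only uses it for `k = k̄`.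
* "rational basis of `Φ_ν ⊗ ℚ`" ↦ `IsRationalBasis` (elementary form; equivalently the family
  is `ℤ`-linearly independent in the value group and `n` is the tree's `ratRank O` of
  `TranscendenceDefect.lean` — not proved here). The first `n ≤ m` new variables are addressed
  by `Fin.castLE`.
* Nothing is asserted: `ELU`, `ELUInDim` are predicates; `ELUInDim 4` is the open input.
-/

noncomputable section

open Polynomial

namespace Literature.AlgebraicGeometry.Resolution

universe u

/-- A finite family `γ` of values of a valuation `v` on a field `K` is a **rational basis of
the value group** `Φ_v ⊗ ℚ` ("`{ν(x₁(1)),…,ν(x_n(1))}` is a rational basis of `Φ_ν ⊗ ℚ`",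
Cutkosky–Mourtada 2019, Def. 1.2): the `γ i` are nonzero, multiplicatively independent over
`ℤ`, and every value `v y`, `y ≠ 0`, has a positive power in the subgroup they generate.
[cite: CutkoskyMourtada2019, §1 Def. 1.2 (the rational-basis clause)] -/
def IsRationalBasis {K : Type*} [Field K] {Γ₀ : Type*} [LinearOrderedCommGroupWithZero Γ₀]
    (v : Valuation K Γ₀) {ι : Type*} [Fintype ι] (γ : ι → Γ₀) : Prop :=
  (∀ i, γ i ≠ 0) ∧ (∀ e : ι → ℤ, ∏ i, γ i ^ e i = 1 → e = 0) ∧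
    ∀ y : K, y ≠ 0 → ∃ (N : ℕ) (e : ι → ℤ), 0 < N ∧ v y ^ N = ∏ i, γ i ^ e i

/-- **Embedded local uniformization in dimension `m` over the ground field `k`**
(Cutkosky–Mourtada 2019, Def. 1.2, with the renderings of the module docstring): for every
field `K ⊇ k`, every algebraically independent `x : Fin m → K` with `Frac k[x] = K`, every
valuation ring `O ⊇ k` of `K` with residue classes represented by constants (zero-dimensional,
for `k = k̄`) dominating `k[x]_{(x)}` (`x i ∈ O`, `ν(x i) < 1`), and every nonzero `f ∈ k[x]`:
there are algebraically independent `x₁ : Fin m → K` with `k[x] ⊆ k[x₁]` (a birational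
extension of polynomial rings), `O` dominating `k[x₁]_{(x₁)}`, an `n ≤ m` such that
`ν(x₁ 0),…,ν(x₁ (n-1))` is a rational basis of the value group, and
`f = x₁(0)^{b₀}⋯x₁(n-1)^{b_{n-1}}·f̄` with `f̄ ∈ k[x₁]`, `ν(f̄) = 1`. A predicate in `k` and `m`,
asserted nowhere. [cite: CutkoskyMourtada2019, §1 Def. 1.2] -/
def ELU (k : Type u) [Field k] (m : ℕ) : Prop :=
  ∀ (K : Type u) [Field K] [Algebra k K] (x : Fin m → K),
    AlgebraicIndependent k x → IsFractionRing (Algebra.adjoin k (Set.range x)) K →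
  ∀ (O : ValuationSubring K), (∀ c : k, algebraMap k K c ∈ O) →
    (∀ y : K, y ∈ O → ∃ c : k, O.valuation (y - algebraMap k K c) < 1) →
    (∀ i, x i ∈ O) → (∀ i, O.valuation (x i) < 1) →
  ∀ f : K, f ∈ Algebra.adjoin k (Set.range x) → f ≠ 0 →
    ∃ x₁ : Fin m → K, AlgebraicIndependent k x₁ ∧
      (∀ i, x i ∈ Algebra.adjoin k (Set.range x₁)) ∧
      (∀ i, x₁ i ∈ O) ∧ (∀ i, O.valuation (x₁ i) < 1) ∧
      ∃ (n : ℕ) (hn : n ≤ m),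
        IsRationalBasis O.valuation (fun i : Fin n => O.valuation (x₁ (Fin.castLE hn i))) ∧
        ∃ (b : Fin n → ℕ) (fbar : K), fbar ∈ Algebra.adjoin k (Set.range x₁) ∧
          O.valuation fbar = 1 ∧ f = (∏ i, x₁ (Fin.castLE hn i) ^ b i) * fbar

/-- **"ELU holds in dimension `m`"** (Cutkosky–Mourtada 2019, Def. 1.2): `ELU k m` for every
algebraically closed field `k`. Printed status: part of every known proof of local
uniformization in dimension `m ≥ 3` (§1: "All of the above proofs … require that embedded local
uniformization … be true for hypersurfaces embedded in … a nonsingular variety of dimension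
`m`"); "we do not know ELU in dimension `4`" (§1) — `ELUInDim 4` is the open local input O1 of
the dimension-`4` census, asserted nowhere. [cite: CutkoskyMourtada2019, §1 Def. 1.2] -/
def ELUInDim (m : ℕ) : Prop :=
  ∀ (k : Type u) [Field k] [IsAlgClosed k], ELU k m

/-- `ELUInDim m` specialises to each algebraically closed field. [folklore] -/
theorem ELUInDim.elu {m : ℕ} (h : ELUInDim.{u} m) (k : Type u) [Field k] [IsAlgClosed k] :
    ELU k m :=
  h k

/-! ## Dimension one (proved): sanity for the shape of the definition -/

section DimOne

variable {k K : Type u} [Field k] [Field K] [Algebra k K] (O : ValuationSubring K)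

/-- A nonzero constant has value `1` for a valuation ring containing the ground field.
[folklore] -/
theorem ELU.valuation_algebraMap_eq_one (hk : ∀ c : k, algebraMap k K c ∈ O) {c : k} (hc : c ≠ 0) :
    O.valuation (algebraMap k K c) = 1 := by
  apply le_antisymm ((O.valuation_le_one_iff _).mpr (hk c))
  have h := (O.valuation_le_one_iff _).mpr (hk c⁻¹)
  have hne : O.valuation (algebraMap k K c) ≠ 0 :=
    (Valuation.ne_zero_iff _).mpr ((_root_.map_ne_zero _).mpr hc)
  rwa [map_inv₀, map_inv₀, inv_le_one₀ (zero_lt_iff.mpr hne)] at h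

/-- `k[t] ⊆ O` as soon as `k ⊆ O` and `t ∈ O`. [folklore] -/
theorem ELU.adjoin_singleton_le_valuationSubring (hk : ∀ c : k, algebraMap k K c ∈ O) {t : K}
    (htO : t ∈ O) {y : K} (hy : y ∈ Algebra.adjoin k ({t} : Set K)) : y ∈ O := by
  let S : Subalgebra k K := { O.toSubring with algebraMap_mem' := hk }
  have hle : Algebra.adjoin k ({t} : Set K) ≤ S :=
    Algebra.adjoin_le (Set.singleton_subset_iff.mpr htO)
  exact hle hy

/-- A polynomial with nonzero constant term is a unit at the centre: `ν(Q(t)) = 1` when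
`k ⊆ O`, `t ∈ O`, `ν(t) < 1` and `Q(0) ≠ 0`. [folklore] -/
theorem ELU.valuation_aeval_eq_one (hk : ∀ c : k, algebraMap k K c ∈ O) {t : K} (htO : t ∈ O)
    (ht : O.valuation t < 1) {Q : k[X]} (hQ : Q.coeff 0 ≠ 0) :
    O.valuation (aeval t Q) = 1 := by
  have hdec : aeval t Q = t * aeval t Q.divX + algebraMap k K (Q.coeff 0) := by
    conv_lhs => rw [← X_mul_divX_add Q]
    simp only [map_add, map_mul, aeval_X, aeval_C]
  have hc : O.valuation (algebraMap k K (Q.coeff 0)) = 1 := ELU.valuation_algebraMap_eq_one O hk hQ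
  have hmem : aeval t Q.divX ∈ Algebra.adjoin k ({t} : Set K) := by
    rw [Algebra.adjoin_singleton_eq_range_aeval]
    exact ⟨Q.divX, rfl⟩
  have hlt : O.valuation (t * aeval t Q.divX) < O.valuation (algebraMap k K (Q.coeff 0)) := by
    rw [hc, map_mul]
    exact mul_lt_one_of_lt_of_le ht
      ((O.valuation_le_one_iff _).mpr (ELU.adjoin_singleton_le_valuationSubring O hk htO hmem))
  rw [hdec, Valuation.map_add_eq_of_lt_right _ hlt, hc]

/-- Factoring the `X`-adic part off a nonzero polynomial: `P = X^a · Q` with `Q(0) ≠ 0`.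
[folklore] -/
theorem ELU.exists_eq_X_pow_mul_coeff_zero_ne_zero (P : k[X]) (hP : P ≠ 0) :
    ∃ (a : ℕ) (Q : k[X]), Q.coeff 0 ≠ 0 ∧ P = X ^ a * Q := by
  obtain ⟨Q, hPQ, hndvd⟩ := P.exists_eq_pow_rootMultiplicity_mul_and_not_dvd hP 0
  refine ⟨P.rootMultiplicity 0, Q, ?_, by simpa using hPQ⟩
  rwa [map_zero, sub_zero, X_dvd_iff] at hndvd

/-- Hence `ν(P(t))` is a power of `ν(t)` for every nonzero `P ∈ k[X]`. [folklore] -/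
theorem ELU.exists_valuation_aeval_eq_pow (hk : ∀ c : k, algebraMap k K c ∈ O) {t : K} (htO : t ∈ O)
    (ht : O.valuation t < 1) (P : k[X]) (hP : P ≠ 0) :
    ∃ a : ℕ, O.valuation (aeval t P) = O.valuation t ^ a := by
  obtain ⟨a, Q, hQ, rfl⟩ := ELU.exists_eq_X_pow_mul_coeff_zero_ne_zero P hP
  exact ⟨a, by rw [map_mul, map_pow, aeval_X, map_mul, map_pow,
    ELU.valuation_aeval_eq_one O hk htO ht hQ, mul_one]⟩

/-- In a linearly ordered group with zero, an element `0 < a < 1` has no nonzero integer power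
equal to `1`. [folklore] -/
theorem ELU.zpow_eq_one_imp_eq_zero {Γ₀ : Type*} [LinearOrderedCommGroupWithZero Γ₀] {a : Γ₀}
    (h0 : a ≠ 0) (h1 : a < 1) {z : ℤ} (hz : a ^ z = 1) : z = 0 := by
  have hpos : 0 < a := zero_lt_iff.mpr h0
  rcases lt_trichotomy z 0 with hz0 | rfl | hz0
  · exact absurd hz (ne_of_gt (one_lt_zpow_of_neg₀ hpos h1 hz0))
  · rfl
  · exact absurd hz (ne_of_lt (zpow_lt_one₀ hpos h1 hz0))

/-- **ELU holds in dimension `1`, over every field**: for `f ∈ k[x]` nonzero, `f = x^b · f̄`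
with `f̄(0) ≠ 0`, so `A₁ = A = k[x]`, `n = 1`, and `{ν(x)}` is a rational basis of the value
group of any valuation of `k(x)` dominating `k[x]_{(x)}`. (Sanity check for the shape of
`ELU`; the sources treat dimension `1` as trivial.) [folklore] -/
theorem elu_one (k : Type u) [Field k] : ELU.{u} k 1 := by
  intro K _ _ x hx hfrac O hk _ hxO hxlt f hf hf0
  -- the single variable
  set t : K := x 0 with ht_def
  have hrange : Set.range x = {t} := by
    ext y
    simp only [Set.mem_range, Set.mem_singleton_iff, ht_def]
    constructor
    · rintro ⟨i, rfl⟩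
      rw [Fin.fin_one_eq_zero i]
    · rintro rfl
      exact ⟨0, rfl⟩
  have htO : t ∈ O := hxO 0
  have ht : O.valuation t < 1 := hxlt 0
  have ht0 : t ≠ 0 := by
    intro h
    have := hx (a₁ := MvPolynomial.X 0) (a₂ := 0) (by simp [ht_def.symm.trans h] )
    exact MvPolynomial.X_ne_zero (R := k) (0 : Fin 1) this
  have hvt0 : O.valuation t ≠ 0 := (Valuation.ne_zero_iff _).mpr ht0
  -- every element of `k[x]` is a polynomial in `t`
  have hpoly : ∀ g : K, g ∈ Algebra.adjoin k (Set.range x) → ∃ P : k[X], aeval t P = g := by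
    intro g hg
    rw [hrange, Algebra.adjoin_singleton_eq_range_aeval] at hg
    exact (AlgHom.mem_range _).mp hg
  -- `f = t^a · Q(t)` with `Q(0) ≠ 0`
  obtain ⟨P, hPf⟩ := hpoly f hf
  have hP0 : P ≠ 0 := by
    rintro rfl
    exact hf0 (by rw [← hPf, map_zero])
  obtain ⟨a, Q, hQ, hPQ⟩ := ELU.exists_eq_X_pow_mul_coeff_zero_ne_zero P hP0
  refine ⟨x, hx, fun i => Algebra.subset_adjoin (Set.mem_range_self i), hxO, hxlt, 1, le_rfl,
    ⟨?_, ?_, ?_⟩, fun _ => a, aeval t Q, ?_, ELU.valuation_aeval_eq_one O hk htO ht hQ, ?_⟩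
  -- rational basis: nonzero
  · intro i
    rw [Fin.fin_one_eq_zero i]
    show O.valuation t ≠ 0
    exact hvt0
  -- rational basis: independence
  · intro e he
    rw [Fin.prod_univ_one] at he
    change O.valuation t ^ e 0 = 1 at he
    funext i
    rw [Fin.fin_one_eq_zero i]
    exact ELU.zpow_eq_one_imp_eq_zero hvt0 ht he
  -- rational basis: every value is (up to sign) a power of `ν(t)`
  · intro y hy
    obtain ⟨g, h, hh, rfl⟩ := IsFractionRing.div_surjective (A := Algebra.adjoin k (Set.range x)) y
    have hg0 : (g : K) ≠ 0 := by
      intro hg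
      exact hy (by simp [hg])
    have hh0 : (h : K) ≠ 0 := by
      intro hh'
      exact hy (by simp [hh'])
    obtain ⟨Pg, hPg⟩ := hpoly g g.2
    obtain ⟨Ph, hPh⟩ := hpoly h h.2
    have hPg0 : Pg ≠ 0 := by rintro rfl; exact hg0 (by rw [← hPg, map_zero])
    have hPh0 : Ph ≠ 0 := by rintro rfl; exact hh0 (by rw [← hPh, map_zero])
    obtain ⟨ag, hag⟩ := ELU.exists_valuation_aeval_eq_pow O hk htO ht Pg hPg0
    obtain ⟨ah, hah⟩ := ELU.exists_valuation_aeval_eq_pow O hk htO ht Ph hPh0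
    refine ⟨1, fun _ => (ag : ℤ) - ah, one_pos, ?_⟩
    rw [pow_one, Fin.prod_univ_one]
    show O.valuation ((g : K) / (h : K)) = O.valuation t ^ ((ag : ℤ) - ah)
    rw [zpow_sub₀ hvt0, zpow_natCast, zpow_natCast, map_div₀, ← hPg, ← hPh, hag, hah]
  -- `f̄ ∈ k[x]`
  · rw [hrange, Algebra.adjoin_singleton_eq_range_aeval]
    exact ⟨Q, rfl⟩
  -- the factorisation
  · rw [Fin.prod_univ_one, ← hPf, hPQ, map_mul, map_pow, aeval_X]
    rfl

end DimOne

end Literature.AlgebraicGeometry.Resolution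

end
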